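import Summits.ABC.IUTFork.Joshi.ThetaLociSizes
import Summits.ABC.IUTFork.Joshi.LogVolumesHullsLocus

/-!
# The JOINT projection of the §9.8 carrier (T-22) and the §9.10 carrier (T-23) onto E-t4's `ATS3.LocusDatum`:
# all four spine inputs of [J-III] Thm. 9.9.1 / 9.11.1 / Cor. 9.11.1.1 at a place, from object-level data

K. Joshi, *Construction of Arithmetic Teichmüller Spaces III* (arXiv:2401.13508 **v4**, unrefereed; bib
`Joshi2024ATS3`), proof of Thm. 9.9.1 p.119 l.73 – p.121 l.166 and of Thm. 9.11.1 p.127 l.33–55. Cell abc-iut, block E (rung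
LADDER-ABC:A2.E), seat E-t23 (slot T-23), ASSIGNMENTS §4 (1) «SUPPLIER DISCHARGES across chains» / the carrier debt «E-t4 ↔
T-22/T-23» (§3). Two typings of the same printed numbers `|log_BK(ξ_{w,j})|` at the standard point `z_Θ` exist in the tree,
each projecting onto E-t4's minimal carrier `ATS3.LocusDatum ℓ*` (p428048) with ONE of the two volume-side fields left to
the caller: T-22's `TensorPacketLociDatum.toLocusDatum` (p429205; supplies `theta := standardNorm w`, `supNorm :=
placeSizeJ w`, derives `StandardPointInLocus` from Cor. 9.8.2.6 = `PlaceSizeBounded w`; `hullVol` free) and T-23's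
`ExhibitedDatum.toLocusDatum` (p429037; supplies `hullVol := Vol(hull Θ̃_w)`, derives `HullVolumeLowerBound` from Lem.
9.10.7.1; `supNorm` free). `JointDatum` = an exhibited datum over T-22's carrier whose exhibited elements `τ_j` HAVE the
norms `|log_BK(ξ_{w,j})|` of T-22 (p.127 l.53 «τ_j = log_BK(Ξ_{0,z_j,w})» — the identification both typings presuppose) and
whose `supNorm` is T-22's `placeSizeJ w`; THEN the two projections COINCIDE (`toLocusDatum_eq_t22`), and E-t4's spine at
`w` rests on OBJECT-level named inputs only: (9.9.4) `ValuationScaling` (further reducible to `NormLogBK` ∧ `RootScaling`,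
p429684), Cor. 9.8.2.6 `PlaceSizeBounded w` (T-22), the sign convention, and signature fields (`spine_of_inputs`).
FRAMING: bookkeeping; nothing of Joshi's is asserted; typed ≠ proved; no side taken on [IUTchIII] Cor. 3.12 or on any author.
-/

noncomputable section

namespace Summit.ABC.IUTFork.Joshi.LogVol

open MeasureTheory ATS3

variable {W : Type} {V : W → Type} [∀ w, TopologicalSpace (V w)] {TJ TM : Type} [TopologicalSpace TJ]
  [TopologicalSpace TM] (C : TensorPacketLociDatum W V TJ TM) (w : W)

/-- **The joint datum at the place `w`**: a §9.10 exhibited datum (p429037) with `ℓ* = C.lstar` factors whose exhibited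
elements have the norms `|log_BK(ξ_{w,j})|` of T-22's carrier at the standard point (p.127 l.53 «τ_j = log_BK(Ξ_{0,z_j,w})»),
and whose sup-norm is T-22's `w`-component size (9.8.2.4). SIGNATURE (two identification fields). [claim: Joshi2024ATS3, status: disputed] -/
structure JointDatum (E : Fin C.lstar → Type*) [∀ i, Field (E i)] [∀ i, MeasurableSpace (E i)] (X : Type*)
    [MeasurableSpace X] extends ExhibitedDatum C.lstar E X where
  /-- the exhibited `τ_j` IS `log_BK(Ξ_{0,z_j,w})`: same norm as T-22's class at `(z_Θ)_j`, `w` -/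
  norm_eq : ∀ i, (D i).abs (τ i) = C.standardNorm w i
  /-- the carried sup-norm IS T-22's `w`-component size -/
  supNorm_eq : supNorm = C.placeSizeJ w

namespace JointDatum

variable {C w} {E : Fin C.lstar → Type*} [∀ i, Field (E i)] [∀ i, MeasurableSpace (E i)] {X : Type*} [MeasurableSpace X]
  (Ξ : JointDatum C w E X)

/-- **The two projections coincide**: T-23's `toLocusDatum` of the joint datum IS T-22's `toLocusDatum` at `w` with the
q-side number and the hull volume read from the §9.10 side. PROVED (field by field). [folklore] -/
theorem toLocusDatum_eq_t22 :
    Ξ.toLocusDatum = C.toLocusDatum w Ξ.qroot Ξ.qroot_pos Ξ.qroot_lt_one (Ξ.vol (Ξ.hull Ξ.locus)).toReal := by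
  unfold ExhibitedDatum.toLocusDatum TensorPacketLociDatum.toLocusDatum
  congr 1
  · exact funext Ξ.norm_eq
  · exact Ξ.supNorm_eq

/-- `StandardPointInLocus` of the joint projection, from T-22's Cor. 9.8.2.6 reading `PlaceSizeBounded w`. [folklore] -/
theorem standardPointInLocus (h : C.PlaceSizeBounded w) : Ξ.toLocusDatum.StandardPointInLocus := by
  rw [toLocusDatum_eq_t22]
  exact C.toLocusDatum_standardPointInLocus w h _ _ _ _

/-- **E-t4's spine at the place `w` from object-level inputs only**: (9.9.4) `ValuationScaling`, Cor. 9.8.2.6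
`PlaceSizeBounded w` and the sign convention give Thm. 9.9.1 (sup form), Thm. 9.11.1 (volume form) and Cor. 9.11.1.1 for the
joint projection — the other two of E-t4's four inputs being DERIVED (T-22: `StandardPointInLocus`; T-23:
`HullVolumeLowerBound` = `ExhibitedDatum.hullVolumeLowerBound_toLocusDatum`, p429037). [claim: Joshi2024ATS3, status: disputed] -/
theorem spine_of_inputs (hV : Ξ.toLocusDatum.ValuationScaling) (hB : C.PlaceSizeBounded w)
    (h1 : Ξ.toLocusDatum.LogVolNonpos) :
    Ξ.toLocusDatum.FundamentalEstimateSup ∧ Ξ.toLocusDatum.FundamentalEstimateVol ∧ Ξ.toLocusDatum.Cor91111 :=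
  ⟨Ξ.toLocusDatum.fundamentalEstimateSup_of hV (Ξ.standardPointInLocus hB),
    Ξ.toLocusDatum.fundamentalEstimateVol_of hV Ξ.toExhibitedDatum.hullVolumeLowerBound_toLocusDatum,
    Ξ.toLocusDatum.cor91111_of_inputs hV Ξ.toExhibitedDatum.hullVolumeLowerBound_toLocusDatum h1⟩

/-- The same spine stated on T-22's projection (consumers holding `C.toLocusDatum w …` get the §9.10 hull volume and its
lower bound for free). [claim: Joshi2024ATS3, status: disputed] -/
theorem spine_of_inputs_t22 (hV : Ξ.toLocusDatum.ValuationScaling) (hB : C.PlaceSizeBounded w)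
    (h1 : Ξ.toLocusDatum.LogVolNonpos) :
    (C.toLocusDatum w Ξ.qroot Ξ.qroot_pos Ξ.qroot_lt_one (Ξ.vol (Ξ.hull Ξ.locus)).toReal).FundamentalEstimateVol ∧
      (C.toLocusDatum w Ξ.qroot Ξ.qroot_pos Ξ.qroot_lt_one (Ξ.vol (Ξ.hull Ξ.locus)).toReal).Cor91111 := by
  rw [← toLocusDatum_eq_t22]
  exact ⟨(Ξ.spine_of_inputs hV hB h1).2.1, (Ξ.spine_of_inputs hV hB h1).2.2⟩

end JointDatum

end Summit.ABC.IUTFork.Joshi.LogVol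

end
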